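import Summits.BirchSwinnertonDyer.BirchSwinnertonDyer.Theorems.SignedLowerHalvesBDKimSignedCharValueRankZeroOfPrint
import Summits.BirchSwinnertonDyer.BirchSwinnertonDyer.Theorems.SignedLowerHalvesSharpFlatCharValueRankZeroAllLevelsOfGreenberg
import Summits.BirchSwinnertonDyer.BirchSwinnertonDyer.Theorems.ByReductionTypeAtTwoSupersingularFlatCountTwoOfShaTwo
import Summits.BirchSwinnertonDyer.BirchSwinnertonDyer.Theorems.ThetaPartnerAtTwoSignedControlAtTwoDivOfPoitouTateTotallyReal
import Summits.BirchSwinnertonDyer.BirchSwinnertonDyer.Theorems.ThetaPartnerAtTwoSignedControlAtTwoCasselsOfPT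
import Literature.NumberTheory.EllipticCurves.Sprung2024.ChromaticLocalInjectivityUncondProofs
import HarnessLib

/-!
# B. D. Kim 2013 Cor. 3.15 (`BDKim2013.cor315_signedCharValue_rankZero`, item stmt-BirchSwinnertonDyer-19288 BY NAME)
# RE-KEYED to the generic Poitou–Tate rows over `ℚ` and ONE displayed identity of local theories:
# «Kobayashi's `Sel^±(E/ℚ_∞)` IS Sprung's `Sel^{♭/♯}(E/ℚ_∞)` at `a_p = 0`» — Kim's Thm. 3.14 and «`g_v` injective» LEAVE the base

LADDER-BSD D-0154 (2) INPUTS→UNCONDITIONAL, INPUTS-LIST-2 row F10 (ADDENDUM-5 §C, tranche T2b), seat `bsd-inputs-kim315-p1` (gen 2);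
every theorem `--supports` stmt-BirchSwinnertonDyer-19288 (`SignedLowerHalves.BDKimSignedCharValueRankZero` = `SignedBaseChange.…` =
`PrintX6.InputKimCor315` = the constant `BDKim2013.cor315_signedCharValue_rankZero`). Sequel of `…BDKimSignedCharValueRankZeroOfCassels.lean`
(p610076; kernel `KimCor315.cor315_body_of_cassels_of_localInj_of_coinv`: Cor. 3.15 for ONE datum ⟸ Cassels BY NAME + INJ^ε + COINV^ε)
and `…OfPrint.lean` (p610825; `cor315_of_print` ⟸ {Cassels, Kim «`g_v` injective», Kim Thm. 3.14} BY NAME).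

HONEST FRAMING: THEOREMS ONLY (no definition, no named fact, no instance, no `sorry`); every result is CONDITIONAL on the named
facts / identities displayed as hypotheses; item 19288 is NOT closed; no summit statement is proved; BSD is not proved by any of this.

## Why this file (the T2b transport, ± side)
After p610825 the by-name input F10 rests on {Cassels–Poitou–Tate (`Greenberg1999.casselsSurjectivity_H1Sigma ℚ`, generic),
Kim 2013 Thm. 3.14 (`±`-specific, L), Kim's local step «`g_v` injective for `v ∣ p`» (`±`-specific, L)}. On SPRUNG's side of
the same mathematics (the `♯/♭` local conditions `E^{♯/♭}_{∞,𝔭}` = exact annihilators of `Ker Col^{♯/♭}`, Def. 7.9, and the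
chromatic Selmer groups `Sel^{♯/♭}(E/ℚ_∞)`, Def. 7.11 — tree `Sprung2012.sharpFlatSelmerInfty`) BOTH `±`-specific inputs are
kernel theorems at every odd supersingular prime GIVEN a Honda system: «`r_p` injective»
(`Sprung2024.lem55AllN_sharpFlat_localKerOver_of_layerToInfty_mem_holds`, unconditional) and `(Sel^•_∞)_γ = 0` from CASSELS +
`Ш²(ℚ, E[p^∞]) = 0` + the `•`-local lift above `p` (`SSFlatEC.sharpFlatEndCoinvariants_subsingleton_of_cassels_of_shaTwo`, the
K4-inputs seat's any-prime door; the lift is `SharpFlatCount.hlocp_of_isHondaSystem`, seat l55-p1; `Ш² = 0` is the three generic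
Poitou–Tate rows over `ℚ`, `SignedEC.PrimaryTorsionH2.shaTwo_primary_eq_bot_of_poitouTate`). Sprung (J. Number Theory 132 (2012)
p. 1486, Def. 7.9–7.11 with Kobayashi's Thm. 6.2 / Prop. 8.18–8.23) remarks that for `a_p = 0` the `♯/♭` theory recovers
Kobayashi's `±` theory; in the tree this is the IDENTITY OF SUBGROUPS of `H¹(ℚ_∞, E[p^∞])`
`Kobayashi2003.signedSelmerInfty W κ ε = Sprung2012.sharpFlatSelmerInfty W κ (closureEmb ℚ_v) (a_p) g c col` for the Honda system
`c` and a colour `col` (proved at `p = 2`, `ε = 1`, `col = ♭` modulo Honda clauses by the TP2 width seat: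
`SignedKatoOffTwo.FlatKernel.signedSelmerInfty_eq_sharpFlatSelmerInfty_flat_two`). THIS FILE shows that this identity is ALL the
`±` side needs: under it INJ^ε and COINV^ε transport verbatim (§1–§3), so Cor. 3.15 for the datum follows from the p610076 kernel
(§4), and the by-name fact follows from the four generic Poitou–Tate rows plus the identity-with-Honda-system displayed once
per `(ε, W, p, κ, v)` (§5). NET: F10 ⟸ {PT-Sel, PT-Ш, PT3ℝ, PT2ℝ} (the base of rows 1/7/8) + «Honda system with `Sel^ε = Sel^col`»
(`ε = 1`, odd `p`: the generic TP2 inclusions + Lemma 2.3 + seat honda-p1's primal Honda data — sequel file; `ε = −1`: the `♯` twin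
of `…FlatKernelPlus`, not in the tree) — NO Kim Thm. 3.14, NO INJ^±. §0 records the planners' ADDENDUM-3 §C1 one-liner.

## What is proved (namespace `…Theorems.KimCor315`)
* §0 `cor315_of_poitouTate` (+ three route decls `…_of_poitouTate_of_print`): F10 ⟸ {PT-Sel, Kim «`g_v`», Kim 3.14} by name.
* §1 `nonempty_addEquiv_endCoinvariants_of_eq` (pure algebra: coinvariants of endomorphisms of EQUAL subgroups that agree
  pointwise), `nonempty_addEquiv_signed_sharpFlat_endCoinvariants` (`(Sel^ε_∞)_γ ≃ (Sel^col_∞)_γ` under the identity).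
* §2 `localResOver_eq_zero_of_comap_signedSelmerInfty_of_eq` — INJ^ε at the datum under the identity (Sprung 2024 L5.5 `v = p`).
* §3 `natCard_signedEndCoinvariants_eq_one_of_cassels_of_shaTwo_of_eq` — COINV^ε (`#(Sel^ε_∞)_γ = 1`) under the identity
  ⟸ CASSELS + `Ш² = ⊥` + Honda system (any-prime door + `hlocp_of_isHondaSystem` + AEU).
* §4 `cor315_body_of_cassels_of_shaTwo_of_honda_of_eq`, `cor315_body_of_cassels_of_poitouTate_of_honda_of_eq` — Cor. 3.15 for
  ONE `(W, p, κ, γ, ε, D)`: torsion of `X^ε` and `f(0) = u · p^{ord_p ∏ c_v} · #Sel_{p^∞}(E/ℚ)`.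
* §5 BY NAME: `cor315_of_cassels_of_poitouTate_of_signedEqChromatic`, `cor315_of_poitouTate_of_signedEqChromatic`
  (`PT-Sel → PT-Ш → PT3ℝ → PT2ℝ → TRANSPORT → BDKim2013.cor315_signedCharValue_rankZero`) and the three route decls.

References: [BDKim2013] Cor. 3.15 and proof (pp. 199–200), Thm. 3.14; [Sprung2012] §1 p. 1486, Def. 7.9–7.11 (p. 1503), Thm. 2.2,
Lemma 2.3; [Sprung2024] §5.2 Lemma 5.5 (p. 40); [Kobayashi2003] Def. 1.1, Thm. 6.2, Prop. 8.18–8.23, (9.33); [GreenbergLNM1716]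
§3 Lemma 3.3, §4 Lemmas 4.2–4.7, Prop. 4.13 (p. 122); [MilneADT2006] I Thm. 4.10, Cor. 4.16, Thm. 6.13; [Cassels1964ArithmeticVII].
Credit: seats tp2-p3/k4-p1 (`SignedEC`, `SSFlatEC` doors), l55-p1 (`SharpFlatCount.hlocp_of_isHondaSystem`), tp2-p2x-w2 (the
`p = 2` identity), whose theorems are consumed here at odd `p`.
-/

set_option autoImplicit false
-- the Theorems namespace of this sub repeats the summit name by design (D-0017 nested layout)
set_option linter.dupNamespace false

noncomputable section

open scoped Classical NumberField

open NumberField IsDedekindDomain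

universe u

namespace Summit.BirchSwinnertonDyer.BirchSwinnertonDyer.Theorems.KimCor315

open Literature.NumberTheory.EllipticCurves Literature.NumberTheory.GaloisRepresentations
  WeierstrassCurve ZpExtension Literature.NumberTheory.EllipticCurves.Kobayashi2003
  Literature.NumberTheory.EllipticCurves.Sprung2017 Literature.NumberTheory.EllipticCurves.Sprung2012
  Literature.NumberTheory.EllipticCurves.Sprung2024 Literature.NumberTheory.EllipticCurves.IwasawaDual
  Literature.NumberTheory.EllipticCurves.IwasawaAlgebra Literature.NumberTheory.GaloisCohomology
  Summit.BirchSwinnertonDyer.BirchSwinnertonDyer.Theorems.SignedEC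
  Summit.BirchSwinnertonDyer.BirchSwinnertonDyer.Theorems.SSFlatEC
  Summit.BirchSwinnertonDyer.BirchSwinnertonDyer.Theorems.SharpFlatCount
open Summit.BirchSwinnertonDyer.Rank1Residual.X11b (LocBridge.primaryGaloisModule)
open Literature.NumberTheory.GaloisRepresentations.DiscreteGaloisModule (shaTwo)
/-! ## §0 The planners' one-liner: Cassels re-keyed to PT-Sel under the by-name corollary (ADDENDUM-3 §C1) -/
/-- **B. D. Kim 2013 Cor. 3.15 (`F = ℚ`, `p` odd) — the fact `BDKim2013.cor315_signedCharValue_rankZero` — from the generic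
Poitou–Tate duality for Selmer structures over `ℚ` (Milne ADT I Thm. 4.10 / Greenberg Prop. 4.13 ⟸ `poitouTate_selmerStructure_duality ℚ`,
`SignedEC.CasselsPT.casselsSurjectivity_H1Sigma_of_poitouTate`), Kim's local step «`g_v` injective for `v ∣ p`» and Kim's Thm. 3.14,
ALL BY NAME.** [cite: BDKim2013, Cor. 3.15 (p. 199) and proof (pp. 199–200), Thm. 3.14 (p. 198)]
[cite: MilneADT2006, Ch. I, Thm. 4.10 (p. 57)] [cite: GreenbergLNM1716, §4 Prop. 4.13 (p. 122)] -/
theorem cor315_of_poitouTate (hPTs : poitouTate_selmerStructure_duality ℚ)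
    (hI : BDKim2013.cor315proof_localResOver_eq_zero_of_layerToInfty_mem_signedSelmerInfty)
    (hK : BDKim2013.thm314_signedSelmerDual_noFiniteSubmodule) :
    BDKim2013.cor315_signedCharValue_rankZero :=
  cor315_of_print (CasselsPT.casselsSurjectivity_H1Sigma_of_poitouTate hPTs) hI hK

/-- **Route `SignedLowerHalves`, support `BDKimSignedCharValueRankZero` (item 19288) ⟸ {PT-Sel, Kim «`g_v` injective», Kim Thm. 3.14}
BY NAME.** CONDITIONAL result; the item is not closed. [cite: BDKim2013, Cor. 3.15 (p. 199)] [cite: MilneADT2006, Ch. I, Thm. 4.10] -/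
theorem signedLowerHalves_bdKimSignedCharValueRankZero_of_poitouTate_of_print
    (hPTs : poitouTate_selmerStructure_duality ℚ)
    (hI : BDKim2013.cor315proof_localResOver_eq_zero_of_layerToInfty_mem_signedSelmerInfty)
    (hK : BDKim2013.thm314_signedSelmerDual_noFiniteSubmodule) :
    Summit.BirchSwinnertonDyer.BirchSwinnertonDyer.Theses.SignedLowerHalves.BDKimSignedCharValueRankZero :=
  cor315_of_poitouTate hPTs hI hK

/-- **Route `SignedBaseChange`, support `BDKimSignedCharValueRankZero` (item 19288) ⟸ {PT-Sel, Kim «`g_v` injective», Kim Thm. 3.14}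
BY NAME.** CONDITIONAL result; the item is not closed. [cite: BDKim2013, Cor. 3.15 (p. 199)] [cite: MilneADT2006, Ch. I, Thm. 4.10] -/
theorem signedBaseChange_bdKimSignedCharValueRankZero_of_poitouTate_of_print
    (hPTs : poitouTate_selmerStructure_duality ℚ)
    (hI : BDKim2013.cor315proof_localResOver_eq_zero_of_layerToInfty_mem_signedSelmerInfty)
    (hK : BDKim2013.thm314_signedSelmerDual_noFiniteSubmodule) :
    Summit.BirchSwinnertonDyer.BirchSwinnertonDyer.Theses.SignedBaseChange.BDKimSignedCharValueRankZero :=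
  cor315_of_poitouTate hPTs hI hK

/-- **Route `PrintX6`, support `InputKimCor315` (item 19288) ⟸ {PT-Sel, Kim «`g_v` injective», Kim Thm. 3.14} BY NAME.**
CONDITIONAL result; the item is not closed. [cite: BDKim2013, Cor. 3.15 (p. 199)] [cite: MilneADT2006, Ch. I, Thm. 4.10] -/
theorem printX6_inputKimCor315_of_poitouTate_of_print (hPTs : poitouTate_selmerStructure_duality ℚ)
    (hI : BDKim2013.cor315proof_localResOver_eq_zero_of_layerToInfty_mem_signedSelmerInfty)
    (hK : BDKim2013.thm314_signedSelmerDual_noFiniteSubmodule) :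
    Summit.BirchSwinnertonDyer.BirchSwinnertonDyer.Theses.PrintX6.InputKimCor315 :=
  cor315_of_poitouTate hPTs hI hK

/-! ## §1 Coinvariants transport across an identity of subgroups (pure algebra) -/
/-- **Coinvariants of endomorphisms of EQUAL subgroups that agree pointwise are isomorphic** (`S₁ = S₂ ≤ A`, `ψᵢ ∈ End Sᵢ`
with `ψ₁ s = ψ₂ s` in `A`: `S₁/(ψ₁ − 1)S₁ ≃ S₂/(ψ₂ − 1)S₂`). Bookkeeping (`subst`); used to move `(Sel_∞)_γ = Sel_∞/(conj_γ − 1)`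
between two descriptions of the same Selmer group. [cite: GreenbergLNM1716, §4 p. 104 (the coinvariants `S_Γ`)] -/
theorem nonempty_addEquiv_endCoinvariants_of_eq {A : Type u} [AddCommGroup A] {S₁ S₂ : AddSubgroup A} (h : S₁ = S₂)
    (ψ₁ : AddMonoid.End S₁) (ψ₂ : AddMonoid.End S₂)
    (hψ : ∀ s : S₁, ((ψ₁ s : S₁) : A) = ((ψ₂ ⟨(s : A), h ▸ s.2⟩ : S₂) : A)) :
    Nonempty (EndCoinvariants (ψ₁ - 1) ≃+ EndCoinvariants (ψ₂ - 1)) := by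
  subst h
  obtain rfl : ψ₁ = ψ₂ := AddMonoidHom.ext fun s ↦ Subtype.ext (hψ s)
  exact ⟨AddEquiv.refl _⟩

variable {W : WeierstrassCurve ℚ} [W.IsElliptic] {p : ℕ} [Fact p.Prime] {κ : ZpExtension ℚ p} {ε : ℤˣ}
  {v : HeightOneSpectrum (𝓞 ℚ)} {ap : ℤ} {g : Field.absoluteGaloisGroup (v.adicCompletion ℚ)}
  {c : ℕ → localPoints W (v.adicCompletion ℚ)} {col : Chroma}

omit [W.IsElliptic] in
/-- **`(Sel^ε(E/ℚ_∞))_γ ≃ (Sel^col(E/ℚ_∞))_γ` under the identity `Sel^ε_∞ = Sel^col_∞`** (both `Λ`-actions are the restriction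
of `conj_γ` on `H¹(ℚ_∞, E[p^∞])`: `Kobayashi2003.conjSignedSelmerInfty`, `Sprung2012.conjSharpFlatSelmerInfty`).
[cite: Kobayashi2003, Def. 1.1 (sentence following it, p. 2)] [cite: Sprung2012, Def. 7.11 (p. 1503)] -/
theorem nonempty_addEquiv_signed_sharpFlat_endCoinvariants
    (heq : signedSelmerInfty W κ ε = sharpFlatSelmerInfty W κ (closureEmb (K := ℚ) (v.adicCompletion ℚ)) ap g c col)
    (γ : Field.absoluteGaloisGroup ℚ) :
    Nonempty (EndCoinvariants (conjSignedSelmerInfty W κ ε γ - 1) ≃+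
      EndCoinvariants (conjSharpFlatSelmerInfty W κ (closureEmb (K := ℚ) (v.adicCompletion ℚ)) ap g c col γ - 1)) :=
  nonempty_addEquiv_endCoinvariants_of_eq heq _ _ fun _ ↦ rfl

omit [W.IsElliptic] in
/-- **Hence `#(Sel^ε_∞)_γ = #(Sel^col_∞)_γ` under the identity.** [cite: Kobayashi2003, Def. 1.1] [cite: Sprung2012, Def. 7.11 (p. 1503)] -/
theorem natCard_signedEndCoinvariants_eq_of_eq
    (heq : signedSelmerInfty W κ ε = sharpFlatSelmerInfty W κ (closureEmb (K := ℚ) (v.adicCompletion ℚ)) ap g c col)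
    (γ : Field.absoluteGaloisGroup ℚ) :
    Nat.card (EndCoinvariants (conjSignedSelmerInfty W κ ε γ - 1)) =
      Nat.card (EndCoinvariants (conjSharpFlatSelmerInfty W κ (closureEmb (K := ℚ) (v.adicCompletion ℚ)) ap g c col γ - 1)) := by
  obtain ⟨e⟩ := nonempty_addEquiv_signed_sharpFlat_endCoinvariants heq γ
  exact Nat.card_congr e.toEquiv

/-! ## §2 INJ^ε at the datum under the identity: Sprung 2024 Lemma 5.5, case `v = p` («`r_p` injective»), transported -/
/-- **Kim's «`g_v` is injective for `v ∣ p`» (INJ^ε) for ONE `(W, p, κ, ε)`, under the identity `Sel^ε_∞ = Sel^col_∞` for a Honda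
system `(cneg, c)` with local generator lift `g` at the place `v ∋ p`:** every `y ∈ H¹(ℚ, E[p^∞])` with `h_0 y ∈ Sel^ε(E/ℚ_∞)` satisfies
the classical local condition at every place above `p`. Indeed `h_0 y ∈ Sel^col_∞` carries the `col`-condition at `𝔭` (the `σ = 1`
component of `Sprung2012.mem_sharpFlatSelmerInfty_iff`), and Sprung 2024 Lemma 5.5 (`v = p`, every conductor; tree theorem
`Sprung2024.lem55AllN_sharpFlat_localKerOver_of_layerToInfty_mem_holds`) gives `y ∈ ker(loc_p)`; `ℚ` has one place above `p`.
[cite: Sprung2024, §5.2 proof of Lemma 5.5, case v = p (p. 40)] [cite: BDKim2013, proof of Cor. 3.15 (p. 199–200)]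
[cite: Kobayashi2003, (9.33)] -/
theorem localResOver_eq_zero_of_comap_signedSelmerInfty_of_eq [W.IsGloballyMinimal] (hp2 : p ≠ 2)
    (hgood : W.HasGoodReductionAtPrime p) (hap : (p : ℤ) ∣ W.frobeniusTrace p) (hκ : κ.IsCyclotomic)
    (hv : (p : 𝓞 ℚ) ∈ v.asIdeal) (hg : κ.IsTopGenerator (resGalOfEmb (closureEmb (K := ℚ) (v.adicCompletion ℚ)) g))
    {cneg : localPoints W (v.adicCompletion ℚ)}
    (hH : IsHondaSystem κ (closureEmb (K := ℚ) (v.adicCompletion ℚ)) W (W.frobeniusTrace p) g cneg c)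
    (heq : signedSelmerInfty W κ ε =
      sharpFlatSelmerInfty W κ (closureEmb (K := ℚ) (v.adicCompletion ℚ)) (W.frobeniusTrace p) g c col) :
    ∀ w : HeightOneSpectrum (𝓞 ℚ), (p : 𝓞 ℚ) ∈ w.asIdeal →
      ∀ y ∈ (signedSelmerInfty W κ ε).comap (W.layerToInfty κ 0),
        W.localResOver p (κ.layerSubgroup 0) (w.adicCompletion ℚ) y = 0 := by
  intro w hw y hy
  obtain rfl : w = v :=
    HeightOneSpectrum.eq_of_natCast_mem_rat (Fact.out : p.Prime) (by exact_mod_cast hw) (by exact_mod_cast hv)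
  rw [AddSubgroup.mem_comap, heq, mem_sharpFlatSelmerInfty_iff] at hy
  have h1 := hy.2 1
  rw [W.conjH1_one_holds p κ.kerSubgroup, AddMonoidHom.id_apply] at h1
  exact (W.mem_localKerOver_iff p (κ.layerSubgroup 0) (w.adicCompletion ℚ) y).mp
    (lem55AllN_sharpFlat_localKerOver_of_layerToInfty_mem_holds W p hp2 hgood hap κ hκ w hv g hg cneg c hH col y h1)

/-! ## §3 COINV^ε at the datum under the identity: `#(Sel^ε_∞)_γ = 1` from CASSELS + `Ш² = ⊥` + the Honda system -/
/-- **`#(Sel^ε(E/ℚ_∞))_γ = 1` (the conclusion Kim draws from Thm. 3.14) for ONE `(W, p, κ, γ, ε)`, under the identity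
`Sel^ε_∞ = Sel^col_∞`, from CASSELS by name, `Sel_{p^∞}(E/ℚ)` finite and `Ш²(ℚ, E[p^∞]) = ⊥` — no Thm. 3.14, no dual datum.**
`(Sel^col_∞)_γ = 0` is the K4-inputs seat's any-prime door `SSFlatEC.sharpFlatEndCoinvariants_subsingleton_of_cassels_of_shaTwo`
(«LIFT′» on all of `H¹(ℚ_∞, E[p^∞])` + DIV from `Ш² = ⊥`), whose `col`-local lift above `p` is the Honda-system theorem
`SharpFlatCount.hlocp_of_isHondaSystem` (its `unramifiedOutside` binder fed by AEU, `SignedEC.ResTwo.exists_finset_mem_unramifiedOutside`)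
and whose `#E(ℚ)[p^∞] = 1` is `natCard_fixedPoints_geomPrimaryTorsion_eq_one_of_supersingular`; then §1 moves the count to `Sel^ε_∞`.
[cite: BDKim2013, Thm. 3.14 (p. 198) and proof of Cor. 3.15 (p. 200)] [cite: GreenbergLNM1716, §3 Lemma 3.3 (p. 87), §4 Lemma 4.7
(pp. 107–108), Prop. 4.13 / p. 122] [cite: Sprung2012, Def. 7.9, Lemma 7.10, Lemma 2.3, Thm. 2.2] -/
theorem natCard_signedEndCoinvariants_eq_one_of_cassels_of_shaTwo_of_eq [W.IsGloballyMinimal] (hp2 : p ≠ 2)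
    (hgood : W.HasGoodReductionAtPrime p) (hap : (p : ℤ) ∣ W.frobeniusTrace p) (hκ : κ.IsCyclotomic)
    {γ : Field.absoluteGaloisGroup ℚ} (hγ : κ.IsTopGenerator γ) (hv : (p : 𝓞 ℚ) ∈ v.asIdeal)
    (hg : κ.IsTopGenerator (resGalOfEmb (closureEmb (K := ℚ) (v.adicCompletion ℚ)) g))
    {cneg : localPoints W (v.adicCompletion ℚ)}
    (hH : IsHondaSystem κ (closureEmb (K := ℚ) (v.adicCompletion ℚ)) W (W.frobeniusTrace p) g cneg c)
    (heq : signedSelmerInfty W κ ε =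
      sharpFlatSelmerInfty W κ (closureEmb (K := ℚ) (v.adicCompletion ℚ)) (W.frobeniusTrace p) g c col)
    (hC : Greenberg1999.casselsSurjectivity_H1Sigma ℚ) (hSel : Finite (W.selmerGroupPInfty p))
    (hsha : shaTwo (LocBridge.primaryGaloisModule W p) = ⊥) :
    Nat.card (EndCoinvariants (conjSignedSelmerInfty W κ ε γ - 1)) = 1 := by
  have hv' : ((p : ℕ) : 𝓞 ℚ) ∈ v.asIdeal := by exact_mod_cast hv
  have htors : Nat.card (MulAction.fixedPoints (Field.absoluteGaloisGroup ℚ) (W.geomPrimaryTorsion p)) = 1 :=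
    natCard_fixedPoints_geomPrimaryTorsion_eq_one_of_supersingular W p hp2 hgood hap
  haveI := sharpFlatEndCoinvariants_subsingleton_of_cassels_of_shaTwo W κ (W.frobeniusTrace p) g c col hκ hγ hv' hC
    hSel htors hsha (fun t hconj w hw ↦ by
      -- AEU: `t` is unramified outside some finite `S₀`; the Honda-system lift ignores which
      obtain ⟨S₀, -, htH⟩ := ResTwo.exists_finset_mem_unramifiedOutside W p κ.kerSubgroup t
      exact hlocp_of_isHondaSystem W p hp2 hgood hap κ hκ hv hg hH col S₀ t htH hconj w hw)
  rw [natCard_signedEndCoinvariants_eq_of_eq heq γ]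
  exact Nat.card_unique

/-! ## §4 Cor. 3.15 for ONE datum from CASSELS + `Ш² = ⊥` (or the three Poitou–Tate rows) + the Honda system + the identity -/
/-- **B. D. Kim's Cor. 3.15 for ONE `(W, p, κ, γ, ε, D)` — from CASSELS by name, `Ш²(ℚ, E[p^∞]) = ⊥` (granted `Sel_{p^∞}(E/ℚ)`
finite), a Honda system `(cneg, c)` with local generator lift `g` at `v ∋ p`, and the identity `Sel^ε(E/ℚ_∞) = Sel^col(E/ℚ_∞)`.**
`W/ℚ` elliptic, globally minimal; `p ≠ 2` good with `a_p = 0`; `κ` cyclotomic with topological generator `γ`; `ε` a sign; `D` a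
Pontryagin-dual datum of `Sel^ε(E/ℚ_∞)`; `Sel_{p^∞}(E/ℚ)` finite. THEN `X^ε = D.X` is `Λ`-torsion and for every generator `f` of
`char X^ε`: **`f(0) = u · p^{ord_p(∏_v c_v)} · #Sel_{p^∞}(E/ℚ)`**, `u ∈ ℤ_pˣ`. The p610076 kernel
`cor315_body_of_cassels_of_localInj_of_coinv` with INJ^ε := §2 and COINV^ε := §3 — Kim's two `±`-specific inputs («`g_v` injective»,
Thm. 3.14) are NOT hypotheses here. [cite: BDKim2013, Cor. 3.15 and its proof (pp. 199–200)]
[cite: GreenbergLNM1716, §4 Lemmas 4.2, 4.3, 4.7, Prop. 4.13 (pp. 102–108, 122)] [cite: Sprung2024, §5.2 Lemma 5.5 (p. 40)]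
[cite: Sprung2012, §1 p. 1486, Def. 7.9–7.11 (p. 1503)] -/
theorem cor315_body_of_cassels_of_shaTwo_of_honda_of_eq [W.IsGloballyMinimal]
    (hC : Greenberg1999.casselsSurjectivity_H1Sigma ℚ)
    (hp2 : p ≠ 2) (hgood : W.HasGoodReductionAtPrime p) (hap : W.frobeniusTrace p = 0) (hκ : κ.IsCyclotomic)
    {γ : Field.absoluteGaloisGroup ℚ} (hγ : κ.IsTopGenerator γ) (D : SignedSelmerDualData W κ γ ε)
    (hv : (p : 𝓞 ℚ) ∈ v.asIdeal) (hg : κ.IsTopGenerator (resGalOfEmb (closureEmb (K := ℚ) (v.adicCompletion ℚ)) g))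
    {cneg : localPoints W (v.adicCompletion ℚ)}
    (hH : IsHondaSystem κ (closureEmb (K := ℚ) (v.adicCompletion ℚ)) W (W.frobeniusTrace p) g cneg c)
    (heq : signedSelmerInfty W κ ε =
      sharpFlatSelmerInfty W κ (closureEmb (K := ℚ) (v.adicCompletion ℚ)) (W.frobeniusTrace p) g c col)
    (hsha : Finite (W.selmerGroupPInfty p) → shaTwo (LocBridge.primaryGaloisModule W p) = ⊥)
    (hSel : Finite (W.selmerGroupPInfty p)) (f : IwasawaAlgebra p) (hf : D.charIdeal = Ideal.span {f}) :
    Module.IsTorsion (IwasawaAlgebra p) D.X ∧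
      ∃ u : ℤ_[p]ˣ,
        ((PowerSeries.constantCoeff f : ℤ_[p]) : ℚ_[p]) =
          ((u : ℤ_[p]) : ℚ_[p]) * (p : ℚ_[p]) ^ (padicValNat p W.tamagawaProduct) *
            (Nat.card (W.selmerGroupPInfty p) : ℚ_[p]) := by
  have hap' : (p : ℤ) ∣ W.frobeniusTrace p := by rw [hap]; exact dvd_zero _
  exact cor315_body_of_cassels_of_localInj_of_coinv W p hC hp2 hgood hap κ hκ hγ ε D
    (localResOver_eq_zero_of_comap_signedSelmerInfty_of_eq hp2 hgood hap' hκ hv hg hH heq)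
    (fun _ ↦ natCard_signedEndCoinvariants_eq_one_of_cassels_of_shaTwo_of_eq hp2 hgood hap' hκ hγ hv hg hH heq hC
      hSel (hsha hSel))
    hSel f hf

/-- **The same with `Ш²(ℚ, E[p^∞]) = ⊥` DISCHARGED to the three generic Poitou–Tate rows over `ℚ`** (Milne ADT I Thm. 4.10 (a),
(c) with `r = 3`, Cor. 4.16; `ℚ` totally real; `E(ℚ)[p] = 0` at a good supersingular `p ≥ 3`, `no_pTorsion_of_supersingular`):
the K4-inputs seat's `SignedEC.PrimaryTorsionH2.shaTwo_primary_eq_bot_of_poitouTate`.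
[cite: BDKim2013, Cor. 3.15 (pp. 199–200)] [cite: MilneADT2006, Ch. I, Thm. 4.10 (a),(c), Cor. 4.16, Thm. 6.13 (c)]
[cite: GreenbergLNM1716, §4 Prop. 4.13 (p. 122)] -/
theorem cor315_body_of_cassels_of_poitouTate_of_honda_of_eq [W.IsGloballyMinimal]
    (hC : Greenberg1999.casselsSurjectivity_H1Sigma ℚ) (hPT : poitouTate_sha_tateDual ℚ)
    (h3 : poitouTate_three_realPlaces_injective ℚ) (h2 : poitouTate_two_realPlaces_surjective ℚ)
    (hp2 : p ≠ 2) (hgood : W.HasGoodReductionAtPrime p) (hap : W.frobeniusTrace p = 0) (hκ : κ.IsCyclotomic)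
    {γ : Field.absoluteGaloisGroup ℚ} (hγ : κ.IsTopGenerator γ) (D : SignedSelmerDualData W κ γ ε)
    (hv : (p : 𝓞 ℚ) ∈ v.asIdeal) (hg : κ.IsTopGenerator (resGalOfEmb (closureEmb (K := ℚ) (v.adicCompletion ℚ)) g))
    {cneg : localPoints W (v.adicCompletion ℚ)}
    (hH : IsHondaSystem κ (closureEmb (K := ℚ) (v.adicCompletion ℚ)) W (W.frobeniusTrace p) g cneg c)
    (heq : signedSelmerInfty W κ ε =
      sharpFlatSelmerInfty W κ (closureEmb (K := ℚ) (v.adicCompletion ℚ)) (W.frobeniusTrace p) g c col)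
    (hSel : Finite (W.selmerGroupPInfty p)) (f : IwasawaAlgebra p) (hf : D.charIdeal = Ideal.span {f}) :
    Module.IsTorsion (IwasawaAlgebra p) D.X ∧
      ∃ u : ℤ_[p]ˣ,
        ((PowerSeries.constantCoeff f : ℤ_[p]) : ℚ_[p]) =
          ((u : ℤ_[p]) : ℚ_[p]) * (p : ℚ_[p]) ^ (padicValNat p W.tamagawaProduct) *
            (Nat.card (W.selmerGroupPInfty p) : ℚ_[p]) := by
  have hap' : (p : ℤ) ∣ W.frobeniusTrace p := by rw [hap]; exact dvd_zero _
  refine cor315_body_of_cassels_of_shaTwo_of_honda_of_eq hC hp2 hgood hap hκ hγ D hv hg hH heq (fun hfin ↦ ?_) hSel f hf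
  haveI := hfin
  -- `E(ℚ)[p] = 0` (the `DecidableEq ℚ` instance of the group law is bridged by `convert`)
  exact PrimaryTorsionH2.shaTwo_primary_eq_bot_of_poitouTate W p hPT h3 h2 fun P hP ↦
    no_pTorsion_of_supersingular W p hp2 hgood hap' P (by convert hP)

end Summit.BirchSwinnertonDyer.BirchSwinnertonDyer.Theorems.KimCor315

/-! ## §5 The Literature fact BY NAME from the four Poitou–Tate rows and the TRANSPORT identity (with its Honda system) -/

namespace Summit.BirchSwinnertonDyer.BirchSwinnertonDyer.Theorems.KimCor315

open Literature.NumberTheory.EllipticCurves Literature.NumberTheory.GaloisRepresentations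
  WeierstrassCurve ZpExtension Literature.NumberTheory.EllipticCurves.Kobayashi2003
  Literature.NumberTheory.EllipticCurves.Sprung2017 Literature.NumberTheory.EllipticCurves.Sprung2012
  Literature.NumberTheory.GaloisCohomology
  Summit.BirchSwinnertonDyer.BirchSwinnertonDyer.Theorems.SignedEC

/-- **B. D. Kim 2013 Cor. 3.15 — the Literature fact `BDKim2013.cor315_signedCharValue_rankZero` ITSELF — from CASSELS by name,
the three generic Poitou–Tate rows over `ℚ`, and the TRANSPORT identity displayed ONCE per `(ε, W, p, κ, v)`:** «there is a
local generator lift `g` at `v`, a Honda system `(cneg, c)` (Sprung 2012 Thm. 2.2) and a colour `col` with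
`Sel^ε(E/ℚ_∞) = Sel^col(E/ℚ_∞)`» (Sprung 2012 p. 1486: at `a_p = 0` the `♯/♭` groups are Kobayashi's `∓/±` groups). So the
by-name input F10 of rows 6–8 is CONDITIONAL exactly on {Greenberg Prop. 4.13, Milne I 4.10 (a), 4.10 (c)₃, 4.16} and that
identity-with-Honda-system; Kim's Thm. 3.14 and «`g_v` injective» are NOT in the base. (`γ` is any topological generator:
the coinvariant door and the Honda system's local lift `g` are independent of it.)
[cite: BDKim2013, Cor. 3.15 (p. 199) and proof (pp. 199–200)] [cite: Sprung2012, §1 p. 1486, Thm. 2.2, Def. 7.9–7.11]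
[cite: GreenbergLNM1716, §4 Prop. 4.13 (p. 122)] [cite: MilneADT2006, Ch. I, Thm. 4.10, Cor. 4.16] -/
theorem cor315_of_cassels_of_poitouTate_of_signedEqChromatic (hC : Greenberg1999.casselsSurjectivity_H1Sigma ℚ)
    (hPT : poitouTate_sha_tateDual ℚ) (h3 : poitouTate_three_realPlaces_injective ℚ)
    (h2 : poitouTate_two_realPlaces_surjective ℚ)
    (hT : ∀ (ε : ℤˣ) (W : WeierstrassCurve ℚ) [W.IsElliptic] [W.IsGloballyMinimal] (p : ℕ) [Fact p.Prime],
      p ≠ 2 → W.HasGoodReductionAtPrime p → W.frobeniusTrace p = 0 →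
      ∀ (κ : ZpExtension ℚ p), κ.IsCyclotomic → ∀ (v : HeightOneSpectrum (𝓞 ℚ)), (p : 𝓞 ℚ) ∈ v.asIdeal →
      ∃ (g : Field.absoluteGaloisGroup (v.adicCompletion ℚ)) (cneg : localPoints W (v.adicCompletion ℚ))
        (c : ℕ → localPoints W (v.adicCompletion ℚ)) (col : Chroma),
        κ.IsTopGenerator (resGalOfEmb (closureEmb (K := ℚ) (v.adicCompletion ℚ)) g) ∧
        IsHondaSystem κ (closureEmb (K := ℚ) (v.adicCompletion ℚ)) W (W.frobeniusTrace p) g cneg c ∧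
        signedSelmerInfty W κ ε =
          sharpFlatSelmerInfty W κ (closureEmb (K := ℚ) (v.adicCompletion ℚ)) (W.frobeniusTrace p) g c col) :
    BDKim2013.cor315_signedCharValue_rankZero := by
  intro W _ _ p _ hp2 hgood hap κ γ hκ hγ ε D _ _ f hf hSel
  obtain ⟨v, hv⟩ : ∃ v : HeightOneSpectrum (𝓞 ℚ), ((p : ℕ) : 𝓞 ℚ) ∈ v.asIdeal :=
    Literature.NumberTheory.EllipticCurves.exists_heightOneSpectrum_natCast_mem (K := ℚ) (Fact.out : p.Prime)
  obtain ⟨g, cneg, c, col, hg, hH, heq⟩ := hT ε W p hp2 hgood hap κ hκ v (by exact_mod_cast hv)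
  exact (cor315_body_of_cassels_of_poitouTate_of_honda_of_eq hC hPT h3 h2 hp2 hgood hap hκ hγ D (by exact_mod_cast hv)
    hg hH heq hSel f hf).2

/-- **B. D. Kim 2013 Cor. 3.15 — `BDKim2013.cor315_signedCharValue_rankZero` — from the FOUR generic Poitou–Tate rows over `ℚ`
and the TRANSPORT identity** (CASSELS discharged to `poitouTate_selmerStructure_duality ℚ` by
`SignedEC.CasselsPT.casselsSurjectivity_H1Sigma_of_poitouTate`): the base of F10 becomes {PT-Sel, PT-Ш, PT3ℝ, PT2ℝ} — the base of
rows 1/7/8 — plus «Honda system with `Sel^ε_∞ = Sel^col_∞`». [cite: BDKim2013, Cor. 3.15 (p. 199)]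
[cite: MilneADT2006, Ch. I, Thm. 4.10, Cor. 4.16, Thm. 6.13, Lemma 6.15] [cite: Sprung2012, §1 p. 1486, Thm. 2.2]
[cite: Cassels1964ArithmeticVII] -/
theorem cor315_of_poitouTate_of_signedEqChromatic (hPTs : poitouTate_selmerStructure_duality ℚ)
    (hPT : poitouTate_sha_tateDual ℚ) (h3 : poitouTate_three_realPlaces_injective ℚ)
    (h2 : poitouTate_two_realPlaces_surjective ℚ)
    (hT : ∀ (ε : ℤˣ) (W : WeierstrassCurve ℚ) [W.IsElliptic] [W.IsGloballyMinimal] (p : ℕ) [Fact p.Prime],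
      p ≠ 2 → W.HasGoodReductionAtPrime p → W.frobeniusTrace p = 0 →
      ∀ (κ : ZpExtension ℚ p), κ.IsCyclotomic → ∀ (v : HeightOneSpectrum (𝓞 ℚ)), (p : 𝓞 ℚ) ∈ v.asIdeal →
      ∃ (g : Field.absoluteGaloisGroup (v.adicCompletion ℚ)) (cneg : localPoints W (v.adicCompletion ℚ))
        (c : ℕ → localPoints W (v.adicCompletion ℚ)) (col : Chroma),
        κ.IsTopGenerator (resGalOfEmb (closureEmb (K := ℚ) (v.adicCompletion ℚ)) g) ∧
        IsHondaSystem κ (closureEmb (K := ℚ) (v.adicCompletion ℚ)) W (W.frobeniusTrace p) g cneg c ∧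
        signedSelmerInfty W κ ε =
          sharpFlatSelmerInfty W κ (closureEmb (K := ℚ) (v.adicCompletion ℚ)) (W.frobeniusTrace p) g c col) :
    BDKim2013.cor315_signedCharValue_rankZero :=
  cor315_of_cassels_of_poitouTate_of_signedEqChromatic (CasselsPT.casselsSurjectivity_H1Sigma_of_poitouTate hPTs)
    hPT h3 h2 hT

/-- **Route `SignedLowerHalves`, support `BDKimSignedCharValueRankZero` (item 19288) ⟸ the four Poitou–Tate rows + TRANSPORT.**
CONDITIONAL result; the item is not closed. [cite: BDKim2013, Cor. 3.15 (p. 199)] [cite: MilneADT2006, Ch. I, Thm. 4.10, Cor. 4.16] -/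
theorem signedLowerHalves_bdKimSignedCharValueRankZero_of_poitouTate_of_signedEqChromatic
    (hPTs : poitouTate_selmerStructure_duality ℚ) (hPT : poitouTate_sha_tateDual ℚ)
    (h3 : poitouTate_three_realPlaces_injective ℚ) (h2 : poitouTate_two_realPlaces_surjective ℚ)
    (hT : ∀ (ε : ℤˣ) (W : WeierstrassCurve ℚ) [W.IsElliptic] [W.IsGloballyMinimal] (p : ℕ) [Fact p.Prime],
      p ≠ 2 → W.HasGoodReductionAtPrime p → W.frobeniusTrace p = 0 →
      ∀ (κ : ZpExtension ℚ p), κ.IsCyclotomic → ∀ (v : HeightOneSpectrum (𝓞 ℚ)), (p : 𝓞 ℚ) ∈ v.asIdeal →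
      ∃ (g : Field.absoluteGaloisGroup (v.adicCompletion ℚ)) (cneg : localPoints W (v.adicCompletion ℚ))
        (c : ℕ → localPoints W (v.adicCompletion ℚ)) (col : Chroma),
        κ.IsTopGenerator (resGalOfEmb (closureEmb (K := ℚ) (v.adicCompletion ℚ)) g) ∧
        IsHondaSystem κ (closureEmb (K := ℚ) (v.adicCompletion ℚ)) W (W.frobeniusTrace p) g cneg c ∧
        signedSelmerInfty W κ ε =
          sharpFlatSelmerInfty W κ (closureEmb (K := ℚ) (v.adicCompletion ℚ)) (W.frobeniusTrace p) g c col) :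
    Summit.BirchSwinnertonDyer.BirchSwinnertonDyer.Theses.SignedLowerHalves.BDKimSignedCharValueRankZero :=
  cor315_of_poitouTate_of_signedEqChromatic hPTs hPT h3 h2 hT

/-- **Route `SignedBaseChange`, support `BDKimSignedCharValueRankZero` (item 19288) ⟸ the four Poitou–Tate rows + TRANSPORT.**
CONDITIONAL result; the item is not closed. [cite: BDKim2013, Cor. 3.15 (p. 199)] [cite: MilneADT2006, Ch. I, Thm. 4.10, Cor. 4.16] -/
theorem signedBaseChange_bdKimSignedCharValueRankZero_of_poitouTate_of_signedEqChromatic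
    (hPTs : poitouTate_selmerStructure_duality ℚ) (hPT : poitouTate_sha_tateDual ℚ)
    (h3 : poitouTate_three_realPlaces_injective ℚ) (h2 : poitouTate_two_realPlaces_surjective ℚ)
    (hT : ∀ (ε : ℤˣ) (W : WeierstrassCurve ℚ) [W.IsElliptic] [W.IsGloballyMinimal] (p : ℕ) [Fact p.Prime],
      p ≠ 2 → W.HasGoodReductionAtPrime p → W.frobeniusTrace p = 0 →
      ∀ (κ : ZpExtension ℚ p), κ.IsCyclotomic → ∀ (v : HeightOneSpectrum (𝓞 ℚ)), (p : 𝓞 ℚ) ∈ v.asIdeal →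
      ∃ (g : Field.absoluteGaloisGroup (v.adicCompletion ℚ)) (cneg : localPoints W (v.adicCompletion ℚ))
        (c : ℕ → localPoints W (v.adicCompletion ℚ)) (col : Chroma),
        κ.IsTopGenerator (resGalOfEmb (closureEmb (K := ℚ) (v.adicCompletion ℚ)) g) ∧
        IsHondaSystem κ (closureEmb (K := ℚ) (v.adicCompletion ℚ)) W (W.frobeniusTrace p) g cneg c ∧
        signedSelmerInfty W κ ε =
          sharpFlatSelmerInfty W κ (closureEmb (K := ℚ) (v.adicCompletion ℚ)) (W.frobeniusTrace p) g c col) :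
    Summit.BirchSwinnertonDyer.BirchSwinnertonDyer.Theses.SignedBaseChange.BDKimSignedCharValueRankZero :=
  cor315_of_poitouTate_of_signedEqChromatic hPTs hPT h3 h2 hT

/-- **Route `PrintX6`, support `InputKimCor315` (item 19288) ⟸ the four Poitou–Tate rows + TRANSPORT.** CONDITIONAL result; the
item is not closed. [cite: BDKim2013, Cor. 3.15 (p. 199)] [cite: MilneADT2006, Ch. I, Thm. 4.10, Cor. 4.16] -/
theorem printX6_inputKimCor315_of_poitouTate_of_signedEqChromatic
    (hPTs : poitouTate_selmerStructure_duality ℚ) (hPT : poitouTate_sha_tateDual ℚ)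
    (h3 : poitouTate_three_realPlaces_injective ℚ) (h2 : poitouTate_two_realPlaces_surjective ℚ)
    (hT : ∀ (ε : ℤˣ) (W : WeierstrassCurve ℚ) [W.IsElliptic] [W.IsGloballyMinimal] (p : ℕ) [Fact p.Prime],
      p ≠ 2 → W.HasGoodReductionAtPrime p → W.frobeniusTrace p = 0 →
      ∀ (κ : ZpExtension ℚ p), κ.IsCyclotomic → ∀ (v : HeightOneSpectrum (𝓞 ℚ)), (p : 𝓞 ℚ) ∈ v.asIdeal →
      ∃ (g : Field.absoluteGaloisGroup (v.adicCompletion ℚ)) (cneg : localPoints W (v.adicCompletion ℚ))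
        (c : ℕ → localPoints W (v.adicCompletion ℚ)) (col : Chroma),
        κ.IsTopGenerator (resGalOfEmb (closureEmb (K := ℚ) (v.adicCompletion ℚ)) g) ∧
        IsHondaSystem κ (closureEmb (K := ℚ) (v.adicCompletion ℚ)) W (W.frobeniusTrace p) g cneg c ∧
        signedSelmerInfty W κ ε =
          sharpFlatSelmerInfty W κ (closureEmb (K := ℚ) (v.adicCompletion ℚ)) (W.frobeniusTrace p) g c col) :
    Summit.BirchSwinnertonDyer.BirchSwinnertonDyer.Theses.PrintX6.InputKimCor315 :=
  cor315_of_poitouTate_of_signedEqChromatic hPTs hPT h3 h2 hT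

end Summit.BirchSwinnertonDyer.BirchSwinnertonDyer.Theorems.KimCor315

end
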